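import Mathlib
import Summits.NavierStokesRegularity.NavierStokesRegularity.Theorems.LerayQuarterDissipationFiniteDissipationLiouvilleEndpointSchemeApex
import Summits.NavierStokesRegularity.NavierStokesRegularity.Theorems.LerayQuarterDissipationFiniteDissipationLiouvilleLocalBalance
import HarnessLib

/-!
# Crux `FiniteDissipationLiouville` (stmt-NavierStokesRegularity-22144): THE LOCAL ENSTROPHY BALANCE NEAR
# THE APEX IS A REGULARITY CRITERION — and the product, cross-flow and threshold-one bounds with it

Theorems file of route `LerayQuarterDissipation` (lead prover g18; `--supports` the crux; sequel of
`…EndpointSchemeApex`, `…LocalBalance`). Navier–Stokes regularity is NOT proved by anything here; no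
summit is.

`…LocalBalance.eq_zero_of_localBalance` needs the Lamb-form balance `⟪u, ω × curl ω⟫ ≤ ‖curl ω‖² + ‖ω‖²/(4(−t))`
at ALL `t < 0`. Through the apex scheme the hypothesis is needed only on a FINAL INTERVAL:

* `localBalance_nsRescale_from`, `localBalance_sim_of_phys_at`, `localBalance_closed_eventually`,
  `antitoneOn_enstrophy_of_localBalance_from` — bookkeeping (scale covariance of the time-restricted
  hypothesis, one-slice similarity form, eventual KNSS-closedness, antitone enstrophy on `[−log(−τ), ∞)`);
* **`not_singular_of_localBalance_near_apex`** — **a KNSS-gauge Type-I ancient mild field with a Type-I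
  envelope whose Lamb-form enstrophy production obeys `⟪u, ω × curl ω⟫ ≤ ‖curl ω‖² + ‖ω‖²/(4(−t))` on
  `[τ, 0) × ℝ³` for SOME `τ < 0` is NOT singular at the apex** (law-free regularity criterion, local in
  time at the potential singularity);
* corollaries on `[τ, 0)`: `not_singular_of_lambProduct_near_apex` (`√(−t)⟪u, ω×curl ω⟫ ≤ ‖ω‖‖curl ω‖`),
  `not_singular_of_crossFlow_near_apex` (`√(−t)‖ω × u‖ ≤ ‖ω‖`), and **`not_singular_of_speed_le_one_near_apex`:
  an enveloped KNSS-gauge Type-I field with `√(−t)‖u(t,x)‖ ≤ 1` for `t ∈ [τ, 0)` is not singular at the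
  apex** — THRESHOLD ONE NEAR THE BLOW-UP TIME, whatever the (larger) global Type-I constant;
* **`localBalance_excess_accumulates_of_singular`** — PORTRAIT: for a singular enveloped member the
  points of local Lamb-form production excess ACCUMULATE AT THE APEX: for every `τ < 0` there is
  `t ∈ [τ, 0)` and `x` with `‖curl ω‖² + ‖ω‖²/(4(−t)) < ⟪u, ω × curl ω⟫`; likewise the super-self-similar
  speed `√(−t)‖u‖ > 1` recurs in every `[τ, 0)`.

HONEST FRAMING. Conditional regularity criteria for a HYPOTHETICAL class (Type-I ancient fields with a
Type-I envelope); conclusion «not singular at the apex» only; for the scaling-recurrent critical element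
of the crux the accumulation is no stronger than the all-time clause. Nothing is removed from the DSS
wall. Nothing here bears on Navier–Stokes regularity.

References: Koch–Nadirashvili–Seregin–Šverák, Acta Math. 203 (2009) §4; folklore energy method.
-/

noncomputable section

set_option linter.dupNamespace false

namespace Summit.NavierStokesRegularity.NavierStokesRegularity.Theorems.FiniteDissipationLiouville.LocalBalance

open MeasureTheory Set Filter Topology Metric InnerProductSpace Function Real
open scoped RealInnerProductSpace ContDiff
open Literature.Analysis Literature.Analysis.FluidPDE
open Summit.NavierStokesRegularity.NavierStokesRegularity.Theorems
open Summit.NavierStokesRegularity.NavierStokesRegularity.Theorems.GaussianGap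
open Summit.NavierStokesRegularity.NavierStokesRegularity.Theorems.SimilarityEnstrophy
open Summit.NavierStokesRegularity.NavierStokesRegularity.Theorems.RecurrentReductionD
open Summit.NavierStokesRegularity.NavierStokesRegularity.Theorems.FiniteDissipationLiouville
open Summit.NavierStokesRegularity.NavierStokesRegularity.Theorems.FiniteDissipationLiouville.CrossFlow
open Summit.NavierStokesRegularity.NavierStokesRegularity.Theorems.FiniteDissipationLiouville.EndpointScheme
open Summit.NavierStokesRegularity.NavierStokesRegularity.Theorems.FiniteDissipationLiouville.LambProduct

variable {C : ℝ} {V : ℝ → EuclideanSpace ℝ (Fin 3) → EuclideanSpace ℝ (Fin 3)}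

/-! ### Bookkeeping for the time-restricted hypothesis -/

section Bookkeeping

/-- **The time-restricted local balance is scale covariant**: the hypothesis on `[τ, 0)` for `V`
gives it on `[τ/c², 0)` for the rescaling `V_c`. [folklore] -/
theorem localBalance_nsRescale_from {c θ τ : ℝ} (hc : 0 < c)
    (hP : ∀ t : ℝ, τ ≤ t → t < 0 → ∀ x, ⟪V t x, cross (curl (V t) x) (curl (curl (V t)) x)⟫ ≤
      θ * (‖curl (curl (V t)) x‖ ^ 2 + ‖curl (V t) x‖ ^ 2 / (4 * (-t)))) :
    ∀ t : ℝ, τ / c ^ 2 ≤ t → t < 0 → ∀ x,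
      ⟪nsRescale c V t x, cross (curl (nsRescale c V t) x) (curl (curl (nsRescale c V t)) x)⟫ ≤
        θ * (‖curl (curl (nsRescale c V t)) x‖ ^ 2 + ‖curl (nsRescale c V t) x‖ ^ 2 / (4 * (-t))) := by
  intro t hτt ht x
  have hct : c ^ 2 * t < 0 := mul_neg_of_pos_of_neg (by positivity) ht
  have hτ' : τ ≤ c ^ 2 * t := by
    have := mul_le_mul_of_nonneg_left hτt (le_of_lt (by positivity : (0:ℝ) < c ^ 2))
    rwa [mul_div_cancel₀ _ (by positivity : c ^ 2 ≠ 0)] at this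
  have key := hP (c ^ 2 * t) hτ' hct (c • x)
  have hcurl : curl (nsRescale c V t) x = (c * c) • curl (V (c ^ 2 * t)) (c • x) := by
    rw [curl_eq_curlCLM, fderiv_nsRescale, map_smul, ← curl_eq_curlCLM]
  rw [hcurl, curl_curl_nsRescale, nsRescale_apply, cross_smul_left, cross_smul_right,
    real_inner_smul_left, real_inner_smul_right, real_inner_smul_right, norm_smul, norm_smul,
    Real.norm_of_nonneg (by positivity : (0:ℝ) ≤ c * c),
    Real.norm_of_nonneg (by positivity : (0:ℝ) ≤ c * c * c)]
  have ht' : 0 < -t := neg_pos.2 ht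
  have h4 : (4 : ℝ) * (-t) ≠ 0 := by positivity
  have h4c : (4 : ℝ) * (-(c ^ 2 * t)) ≠ 0 := by
    rw [show (4 : ℝ) * (-(c ^ 2 * t)) = c ^ 2 * (4 * (-t)) by ring]; positivity
  have e1 : (c * c * ‖curl (V (c ^ 2 * t)) (c • x)‖) ^ 2 / (4 * (-t)) =
      c ^ 6 * (‖curl (V (c ^ 2 * t)) (c • x)‖ ^ 2 / (4 * (-(c ^ 2 * t)))) := by
    rw [mul_div_assoc', div_eq_div_iff h4 h4c]
    ring
  have e : θ * ((c * c * c * ‖curl (curl (V (c ^ 2 * t))) (c • x)‖) ^ 2 +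
      (c * c * ‖curl (V (c ^ 2 * t)) (c • x)‖) ^ 2 / (4 * (-t))) =
      c ^ 6 * (θ * (‖curl (curl (V (c ^ 2 * t))) (c • x)‖ ^ 2 +
        ‖curl (V (c ^ 2 * t)) (c • x)‖ ^ 2 / (4 * (-(c ^ 2 * t))))) := by
    rw [e1]
    ring
  rw [e]
  have hw : 0 ≤ c ^ 6 := by positivity
  calc c * (c * c * (c * c * c *
        ⟪V (c ^ 2 * t) (c • x), cross (curl (V (c ^ 2 * t)) (c • x)) (curl (curl (V (c ^ 2 * t))) (c • x))⟫))
      = c ^ 6 * ⟪V (c ^ 2 * t) (c • x), cross (curl (V (c ^ 2 * t)) (c • x))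
          (curl (curl (V (c ^ 2 * t))) (c • x))⟫ := by ring
    _ ≤ _ := mul_le_mul_of_nonneg_left key hw

/-- **The local balance in similarity variables, one slice**: the physical hypothesis at the time
`t = −e^{−s}` gives `⟪U, Ω × curl Ω⟫ ≤ θ(‖curl Ω‖² + ¼‖Ω‖²)` on the slice `s` of the Leray orbit.
[folklore] -/
theorem localBalance_sim_of_phys_at {θ : ℝ} (s : ℝ)
    (hP : ∀ x, ⟪V (-Real.exp (-s)) x, cross (curl (V (-Real.exp (-s))) x)
        (curl (curl (V (-Real.exp (-s)))) x)⟫ ≤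
      θ * (‖curl (curl (V (-Real.exp (-s)))) x‖ ^ 2 +
        ‖curl (V (-Real.exp (-s))) x‖ ^ 2 / (4 * (-(-Real.exp (-s))))))
    (y : EuclideanSpace ℝ (Fin 3)) :
    ⟪lerayOrbit V s y, cross (lerayVorticity V s y) (curl (lerayVorticity V s) y)⟫ ≤
      θ * (‖curl (lerayVorticity V s) y‖ ^ 2 + (1 / 4) * ‖lerayVorticity V s y‖ ^ 2) := by
  have hl0 : 0 < Real.exp (-s / 2) := Real.exp_pos _
  have hk0 : 0 < Real.exp (-s) := Real.exp_pos _
  have ht0 : -Real.exp (-s) < 0 := neg_neg_of_pos hk0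
  have hU : lerayOrbit V s y = Real.exp (-s / 2) • V (-Real.exp (-s)) (Real.exp (-s / 2) • y) := by
    rw [lerayOrbit_apply]
  have hΩ : lerayVorticity V s y =
      Real.exp (-s) • curl (V (-Real.exp (-s))) (Real.exp (-s / 2) • y) := by
    rw [lerayVorticity_apply, curl_lerayOrbit]
  have hC := curl_lerayVorticity_apply V s y
  have h := hP (Real.exp (-s / 2) • y)
  rw [neg_neg] at h
  set P : ℝ := ⟪V (-Real.exp (-s)) (Real.exp (-s / 2) • y),
      cross (curl (V (-Real.exp (-s))) (Real.exp (-s / 2) • y))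
        (curl (curl (V (-Real.exp (-s)))) (Real.exp (-s / 2) • y))⟫ with hPdef
  set A : ℝ := ‖curl (V (-Real.exp (-s))) (Real.exp (-s / 2) • y)‖ with hA
  set B : ℝ := ‖curl (curl (V (-Real.exp (-s)))) (Real.exp (-s / 2) • y)‖ with hB
  have hee : Real.exp (-s / 2) * Real.exp (-s / 2) = Real.exp (-s) := by
    rw [← Real.exp_add]; congr 1; ring
  have eL : ⟪lerayOrbit V s y, cross (lerayVorticity V s y) (curl (lerayVorticity V s) y)⟫ =
      Real.exp (-s) ^ 3 * P := by
    rw [hU, hΩ, hC, cross_smul_left, cross_smul_right, real_inner_smul_left, real_inner_smul_right,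
      real_inner_smul_right]
    calc Real.exp (-s / 2) * (Real.exp (-s) * (Real.exp (-s) * Real.exp (-s / 2) * P))
        = (Real.exp (-s / 2) * Real.exp (-s / 2)) * Real.exp (-s) ^ 2 * P := by ring
      _ = Real.exp (-s) ^ 3 * P := by rw [hee]; ring
  have eA : ‖lerayVorticity V s y‖ = Real.exp (-s) * A := by
    rw [hΩ, norm_smul, Real.norm_of_nonneg hk0.le]
  have eB : ‖curl (lerayVorticity V s) y‖ = Real.exp (-s) * Real.exp (-s / 2) * B := by
    rw [hC, norm_smul, Real.norm_of_nonneg (mul_pos hk0 hl0).le]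
  have eR : ‖curl (lerayVorticity V s) y‖ ^ 2 + (1 / 4) * ‖lerayVorticity V s y‖ ^ 2 =
      Real.exp (-s) ^ 3 * (B ^ 2 + A ^ 2 / (4 * Real.exp (-s))) := by
    rw [eA, eB]
    have e3 : Real.exp (-s) ^ 3 * (A ^ 2 / (4 * Real.exp (-s))) = Real.exp (-s) ^ 2 * A ^ 2 / 4 := by
      rw [mul_div_assoc', div_eq_div_iff (by positivity) (by norm_num)]
      ring
    calc (Real.exp (-s) * Real.exp (-s / 2) * B) ^ 2 + 1 / 4 * (Real.exp (-s) * A) ^ 2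
        = Real.exp (-s) ^ 2 * (Real.exp (-s / 2) * Real.exp (-s / 2)) * B ^ 2 +
            Real.exp (-s) ^ 2 * A ^ 2 / 4 := by ring
      _ = Real.exp (-s) ^ 3 * B ^ 2 + Real.exp (-s) ^ 3 * (A ^ 2 / (4 * Real.exp (-s))) := by
          rw [hee, e3]; ring
      _ = Real.exp (-s) ^ 3 * (B ^ 2 + A ^ 2 / (4 * Real.exp (-s))) := by ring
  rw [eL, eR, ← mul_assoc, mul_comm θ, mul_assoc]
  exact mul_le_mul_of_nonneg_left h (by positivity)


/-- **Eventual KNSS-closedness**: if `v_j → W` as in `…Compactness.seqLimit` and the local balance holds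
for `v_j` on `[τ_j, 0)` with `τ_j → −∞`, then `W` satisfies it at every `t < 0`.
[cite: KochNadirashviliSereginSverak2009, Prop. 4.1 (arXiv:0709.3599 p. 8)] -/
theorem localBalance_closed_eventually {v : ℕ → ℝ → EuclideanSpace ℝ (Fin 3) → EuclideanSpace ℝ (Fin 3)}
    {W : ℝ → EuclideanSpace ℝ (Fin 3) → EuclideanSpace ℝ (Fin 3)} {τ : ℕ → ℝ}
    (hv : ∀ j, IsTypeIAncientMild C (v j)) (hW : IsTypeIAncientMild C W)
    (hunif : ∀ n : ℕ, TendstoUniformlyOn (fun j z => v j z.1 z.2) (fun z => W z.1 z.2) atTop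
      (Icc (-((n : ℝ) + 2)) (-(1 / ((n : ℝ) + 2))) ×ˢ
        closedBall (0 : EuclideanSpace ℝ (Fin 3)) ((n : ℝ) + 2)))
    (hpt : ∀ t < 0, ∀ x, Tendsto (fun j => v j t x) atTop (𝓝 (W t x)))
    (hgr : ∀ t < 0, ∀ x, Tendsto (fun j => fderiv ℝ (v j t) x) atTop (𝓝 (fderiv ℝ (W t) x)))
    (hP : ∀ j, ∀ t : ℝ, τ j ≤ t → t < 0 → ∀ x,
      ⟪v j t x, cross (curl (v j t) x) (curl (curl (v j t)) x)⟫ ≤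
        1 * (‖curl (curl (v j t)) x‖ ^ 2 + ‖curl (v j t) x‖ ^ 2 / (4 * (-t))))
    (hτ : Tendsto τ atTop atBot) :
    ∀ t < 0, ∀ x, ⟪W t x, cross (curl (W t) x) (curl (curl (W t)) x)⟫ ≤
      1 * (‖curl (curl (W t)) x‖ ^ 2 + ‖curl (W t) x‖ ^ 2 / (4 * (-t))) := by
  intro t ht x
  obtain ⟨a, ha⟩ : ∃ a : ℕ → EuclideanSpace ℝ (Fin 3), ∀ j, a j = v j t x := ⟨_, fun j => rfl⟩
  obtain ⟨b, hb⟩ : ∃ b : ℕ → EuclideanSpace ℝ (Fin 3), ∀ j, b j = curl (v j t) x := ⟨_, fun j => rfl⟩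
  obtain ⟨d, hd⟩ : ∃ d : ℕ → EuclideanSpace ℝ (Fin 3), ∀ j, d j = curl (curl (v j t)) x :=
    ⟨_, fun j => rfl⟩
  have hta : Tendsto a atTop (𝓝 (W t x)) := (hpt t ht x).congr fun j => (ha j).symm
  have htb : Tendsto b atTop (𝓝 (curl (W t) x)) :=
    (tendsto_curl_of_fderiv (hgr t ht x)).congr fun j => (hb j).symm
  have htd : Tendsto d atTop (𝓝 (curl (curl (W t)) x)) :=
    (tendsto_curl_curl_of_unif hv hW hunif ht x).congr fun j => (hd j).symm
  have hcr : Tendsto (fun j => cross (b j) (d j)) atTop (𝓝 (cross (curl (W t) x) (curl (curl (W t)) x))) := by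
    have h := ((crossCLM.continuous₂).tendsto (curl (W t) x, curl (curl (W t)) x)).comp
      (htb.prodMk_nhds htd)
    refine h.congr fun j => ?_
    simp [Function.comp, crossCLM_apply]
  have hL : Tendsto (fun j => ⟪a j, cross (b j) (d j)⟫) atTop
      (𝓝 ⟪W t x, cross (curl (W t) x) (curl (curl (W t)) x)⟫) := hta.inner hcr
  have hR : Tendsto (fun j => 1 * (‖d j‖ ^ 2 + ‖b j‖ ^ 2 / (4 * (-t)))) atTop
      (𝓝 (1 * (‖curl (curl (W t)) x‖ ^ 2 + ‖curl (W t) x‖ ^ 2 / (4 * (-t))))) :=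
    ((htd.norm.pow 2).add ((htb.norm.pow 2).div_const _)).const_mul 1
  refine le_of_tendsto_of_tendsto hL hR ?_
  filter_upwards [hτ.eventually (eventually_le_atBot t)] with j hj
  rw [ha, hb, hd]
  exact hP j t hj ht x

/-- **Antitone enstrophy from the time-restricted balance**: if the Lamb-form balance holds on
`[τ, 0)`, `τ < 0`, for an enveloped KNSS-gauge Type-I field, then `s ↦ ∫‖Ω(s)‖²` is antitone on
`[−log(−τ), ∞)`. [folklore energy method] -/
theorem antitoneOn_enstrophy_of_localBalance_from (hV : IsTypeIAncientMild C V) (hdec : HasTypeIDecay C V)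
    {τ : ℝ} (hτ : τ < 0)
    (hP : ∀ t : ℝ, τ ≤ t → t < 0 → ∀ x, ⟪V t x, cross (curl (V t) x) (curl (curl (V t)) x)⟫ ≤
      1 * (‖curl (curl (V t)) x‖ ^ 2 + ‖curl (V t) x‖ ^ 2 / (4 * (-t)))) :
    AntitoneOn (fun σ => ∫ y, ‖lerayVorticity V σ y‖ ^ 2) (Ici (-Real.log (-τ))) := by
  have hd := fun s => hasDerivAt_enstrophy_eq_neg_two_integral_slack hV hdec s
  refine antitoneOn_of_deriv_nonpos (convex_Ici _) (fun s _ => (hd s).continuousAt.continuousWithinAt)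
    (fun s _ => (hd s).differentiableAt.differentiableWithinAt) fun s hs => ?_
  rw [interior_Ici, mem_Ioi] at hs
  rw [(hd s).deriv]
  -- on this slice `t = −e^{−s} ≥ τ`, so the balance holds and the slack density is nonnegative
  have hts : τ ≤ -Real.exp (-s) := by
    have h1 : Real.exp (-s) < Real.exp (Real.log (-τ)) := Real.exp_lt_exp.2 (by linarith)
    rw [Real.exp_log (neg_pos.2 hτ)] at h1
    linarith
  have ht0 : -Real.exp (-s) < 0 := neg_neg_of_pos (Real.exp_pos _)
  have hslice := localBalance_sim_of_phys_at (V := V) (θ := 1) s (hP _ hts ht0)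
  have hσ : 0 ≤ ∫ y, (‖curl (lerayVorticity V s) y‖ ^ 2 + (1 / 4) * ‖lerayVorticity V s y‖ ^ 2 -
      ⟪lerayOrbit V s y, cross (lerayVorticity V s y) (curl (lerayVorticity V s) y)⟫) :=
    integral_nonneg fun y => by
      have h1 := hslice y
      rw [one_mul] at h1
      exact sub_nonneg.2 h1
  linarith

end Bookkeeping

/-! ### The regularity criterion and its corollaries -/

section Apex

/-- **THE LOCAL ENSTROPHY BALANCE NEAR THE APEX IS A REGULARITY CRITERION (law-free).** A KNSS-gauge
Type-I ancient mild field `V` (`IsTypeIAncientMild C V`) with a Type-I envelope `HasTypeIDecay C V` such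
that, for some `τ < 0`, `⟪V(t,x), ω × curl ω⟫ ≤ ‖curl ω‖² + ‖ω‖²/(4(−t))` for all `t ∈ [τ, 0)` and all
`x`, is NOT singular at the apex. [folklore energy method + KNSS compactness] -/
theorem not_singular_of_localBalance_near_apex (hV : IsTypeIAncientMild C V) (hdec : HasTypeIDecay C V)
    {τ : ℝ} (hτ : τ < 0)
    (hP : ∀ t : ℝ, τ ≤ t → t < 0 → ∀ x, ⟪V t x, cross (curl (V t) x) (curl (curl (V t)) x)⟫ ≤
      ‖curl (curl (V t)) x‖ ^ 2 + ‖curl (V t) x‖ ^ 2 / (4 * (-t))) :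
    ¬ (∀ r > 0, ∀ M : ℝ, ∃ t ∈ Ioo (-(r ^ 2)) (0 : ℝ),
      ∃ x ∈ ball (0 : EuclideanSpace ℝ (Fin 3)) r, M < ‖V t x‖) := by
  have hP1 : ∀ t : ℝ, τ ≤ t → t < 0 → ∀ x, ⟪V t x, cross (curl (V t) x) (curl (curl (V t)) x)⟫ ≤
      1 * (‖curl (curl (V t)) x‖ ^ 2 + ‖curl (V t) x‖ ^ 2 / (4 * (-t))) :=
    fun t h1 h2 x => by rw [one_mul]; exact hP t h1 h2 x
  -- the all-time property and its constant-enstrophy rigidity (from the slack scheme)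
  have hkill := (antitone_and_const_of_slack (C := C)
    (P := fun F => ∀ t < 0, ∀ x, ⟪F t x, cross (curl (F t) x) (curl (curl (F t)) x)⟫ ≤
      1 * (‖curl (curl (F t)) x‖ ^ 2 + ‖curl (F t) x‖ ^ 2 / (4 * (-t))))
    (fun F hF _ hPF s y => by
      have h := localBalance_sim_of_phys hPF s y
      rw [one_mul] at h
      linarith)
    (fun F hF hdF hPF s hσ => by
      refine lerayVorticity_eq_zero_of_eqOn_far hF s (R := max C 0) fun y hy => ?_
      have h := localBalance_sim_of_phys hPF s y
      rw [one_mul] at h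
      have heq : ‖curl (lerayVorticity F s) y‖ ^ 2 + (1 / 4) * ‖lerayVorticity F s y‖ ^ 2 ≤
          ⟪lerayOrbit F s y, cross (lerayVorticity F s y) (curl (lerayVorticity F s) y)⟫ := by
        linarith [hσ y]
      refine eq_zero_of_balance_le_of_norm_lt_one heq ?_
      have hUle := hdF.norm_lerayOrbit_le s y
      have hden : 0 < ‖y‖ + 1 := by positivity
      have hA : C < ‖y‖ + 1 := by linarith [le_max_left C 0, le_max_right C 0]
      exact hUle.trans_lt ((div_lt_one hden).2 hA))).2
  refine not_singular_of_apex_scheme (C := C)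
    (P := fun τ' F => ∀ t : ℝ, τ' ≤ t → t < 0 → ∀ x,
      ⟪F t x, cross (curl (F t) x) (curl (curl (F t)) x)⟫ ≤
        1 * (‖curl (curl (F t)) x‖ ^ 2 + ‖curl (F t) x‖ ^ 2 / (4 * (-t))))
    (Pinf := fun F => ∀ t < 0, ∀ x, ⟪F t x, cross (curl (F t) x) (curl (curl (F t)) x)⟫ ≤
      1 * (‖curl (curl (F t)) x‖ ^ 2 + ‖curl (F t) x‖ ^ 2 / (4 * (-t))))
    (fun F c τ' hc hF => localBalance_nsRescale_from hc hF)
    (fun u W τs hu _ hPu hτs hW hunif hpt hgr =>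
      localBalance_closed_eventually hu hW hunif hpt hgr hPu hτs)
    (fun F τ' hF hdF hτ' hPF => antitoneOn_enstrophy_of_localBalance_from hF hdF hτ' hPF)
    hkill hV hdec hτ hP1

/-- **The product bound near the apex suffices**: `√(−t)⟪V, ω × curl ω⟫ ≤ ‖ω‖‖curl ω‖` on `[τ, 0) × ℝ³`
for an enveloped KNSS-gauge Type-I field forbids the apex singularity. [folklore] -/
theorem not_singular_of_lambProduct_near_apex (hV : IsTypeIAncientMild C V) (hdec : HasTypeIDecay C V)
    {τ : ℝ} (hτ : τ < 0)
    (hP : ∀ t : ℝ, τ ≤ t → t < 0 → ∀ x,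
      Real.sqrt (-t) * ⟪V t x, cross (curl (V t) x) (curl (curl (V t)) x)⟫ ≤
        ‖curl (V t) x‖ * ‖curl (curl (V t)) x‖) :
    ¬ (∀ r > 0, ∀ M : ℝ, ∃ t ∈ Ioo (-(r ^ 2)) (0 : ℝ),
      ∃ x ∈ ball (0 : EuclideanSpace ℝ (Fin 3)) r, M < ‖V t x‖) := by
  refine not_singular_of_localBalance_near_apex hV hdec hτ fun t h1 ht x => ?_
  have ht' : 0 < -t := neg_pos.2 ht
  set r : ℝ := Real.sqrt (-t) with hr
  have hs : 0 < r := Real.sqrt_pos.2 ht'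
  have hss : r * r = -t := Real.mul_self_sqrt ht'.le
  have h1' := hP t h1 ht x
  -- `ab ≤ r(b² + a²/(4r²))`
  have h2 : ‖curl (V t) x‖ * ‖curl (curl (V t)) x‖ ≤
      r * (‖curl (curl (V t)) x‖ ^ 2 + ‖curl (V t) x‖ ^ 2 / (4 * (-t))) := by
    rw [← hss]
    set a : ℝ := ‖curl (V t) x‖
    set b : ℝ := ‖curl (curl (V t)) x‖
    have e : r * (b ^ 2 + a ^ 2 / (4 * (r * r))) = (4 * r ^ 2 * b ^ 2 + a ^ 2) / (4 * r) := by
      rw [eq_div_iff (by positivity)]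
      field_simp
    rw [e, le_div_iff₀ (by positivity)]
    nlinarith [sq_nonneg (2 * r * b - a)]
  exact le_of_mul_le_mul_left (h1'.trans h2) hs

/-- **Cross-flow `≤ 1` near the apex suffices.** [folklore] -/
theorem not_singular_of_crossFlow_near_apex (hV : IsTypeIAncientMild C V) (hdec : HasTypeIDecay C V)
    {τ : ℝ} (hτ : τ < 0)
    (hX : ∀ t : ℝ, τ ≤ t → t < 0 → ∀ x, Real.sqrt (-t) * ‖cross (curl (V t) x) (V t x)‖ ≤ ‖curl (V t) x‖) :
    ¬ (∀ r > 0, ∀ M : ℝ, ∃ t ∈ Ioo (-(r ^ 2)) (0 : ℝ),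
      ∃ x ∈ ball (0 : EuclideanSpace ℝ (Fin 3)) r, M < ‖V t x‖) := by
  refine not_singular_of_lambProduct_near_apex hV hdec hτ fun t h1 ht x => ?_
  have hs : 0 ≤ Real.sqrt (-t) := Real.sqrt_nonneg _
  have hc : ‖cross (curl (V t) x) (Real.sqrt (-t) • V t x)‖ ≤ ‖curl (V t) x‖ := by
    rw [cross_smul_right, norm_smul, Real.norm_of_nonneg hs]; exact hX t h1 ht x
  have h2 := lambProduct_of_crossFlow_le hc (curl (curl (V t)) x)
  rwa [real_inner_smul_left] at h2

/-- **THRESHOLD ONE NEAR THE BLOW-UP TIME.** An enveloped KNSS-gauge Type-I field (any global Type-I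
constant `C`, envelope constant equalised) with `√(−t)‖V(t,x)‖ ≤ 1` for all `t ∈ [τ, 0)`, `x` (some
`τ < 0`) is NOT singular at the apex. [folklore energy method + KNSS compactness] -/
theorem not_singular_of_speed_le_one_near_apex (hV : IsTypeIAncientMild C V) (hdec : HasTypeIDecay C V)
    {τ : ℝ} (hτ : τ < 0) (hb : ∀ t : ℝ, τ ≤ t → t < 0 → ∀ x, Real.sqrt (-t) * ‖V t x‖ ≤ 1) :
    ¬ (∀ r > 0, ∀ M : ℝ, ∃ t ∈ Ioo (-(r ^ 2)) (0 : ℝ),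
      ∃ x ∈ ball (0 : EuclideanSpace ℝ (Fin 3)) r, M < ‖V t x‖) := by
  refine not_singular_of_lambProduct_near_apex hV hdec hτ fun t h1 ht x => ?_
  have hs : 0 ≤ Real.sqrt (-t) := Real.sqrt_nonneg _
  have hU : ‖Real.sqrt (-t) • V t x‖ ≤ 1 := by
    rw [norm_smul, Real.norm_of_nonneg hs]; exact hb t h1 ht x
  have h2 := lambProduct_of_norm_le_one hU (curl (V t) x) (curl (curl (V t)) x)
  rwa [real_inner_smul_left] at h2

/-- **PORTRAIT: the local production excess accumulates at the apex.** A KNSS-gauge Type-I field with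
`IsTypeIAncientMild C V`, `C ≤ A`, a Type-I envelope `HasTypeIDecay A V`, SINGULAR at the apex, has FOR
EVERY `τ < 0` a point `(t, x)` with `τ ≤ t < 0` and `‖curl ω‖² + ‖ω‖²/(4(−t)) < ⟪V(t,x), ω × curl ω⟫`.
[folklore energy method + KNSS compactness] -/
theorem localBalance_excess_accumulates_of_singular {A : ℝ} (hV : IsTypeIAncientMild C V) (hCA : C ≤ A)
    (hdec : HasTypeIDecay A V)
    (hsing : ∀ r > 0, ∀ M : ℝ, ∃ t ∈ Ioo (-(r ^ 2)) (0 : ℝ),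
        ∃ x ∈ ball (0 : EuclideanSpace ℝ (Fin 3)) r, M < ‖V t x‖)
    {τ : ℝ} (hτ : τ < 0) :
    ∃ t : ℝ, τ ≤ t ∧ t < 0 ∧ ∃ x : EuclideanSpace ℝ (Fin 3),
      ‖curl (curl (V t)) x‖ ^ 2 + ‖curl (V t) x‖ ^ 2 / (4 * (-t)) <
        ⟪V t x, cross (curl (V t) x) (curl (curl (V t)) x)⟫ := by
  by_contra h
  push Not at h
  exact not_singular_of_localBalance_near_apex (isTypeIAncientMild_of_le hV hCA) hdec hτ
    (fun t h1 h2 x => h t h1 h2 x) hsing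

/-- **PORTRAIT: the super-self-similar speed recurs up to the apex.** A singular enveloped member has,
for every `τ < 0`, a point `(t,x)` with `τ ≤ t < 0` and `1 < √(−t)‖V(t,x)‖`. [folklore] -/
theorem speed_exceeds_one_accumulates_of_singular {A : ℝ} (hV : IsTypeIAncientMild C V) (hCA : C ≤ A)
    (hdec : HasTypeIDecay A V)
    (hsing : ∀ r > 0, ∀ M : ℝ, ∃ t ∈ Ioo (-(r ^ 2)) (0 : ℝ),
        ∃ x ∈ ball (0 : EuclideanSpace ℝ (Fin 3)) r, M < ‖V t x‖)
    {τ : ℝ} (hτ : τ < 0) :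
    ∃ t : ℝ, τ ≤ t ∧ t < 0 ∧ ∃ x : EuclideanSpace ℝ (Fin 3), 1 < Real.sqrt (-t) * ‖V t x‖ := by
  by_contra h
  push Not at h
  exact not_singular_of_speed_le_one_near_apex (isTypeIAncientMild_of_le hV hCA) hdec hτ
    (fun t h1 h2 x => h t h1 h2 x) hsing

end Apex

end Summit.NavierStokesRegularity.NavierStokesRegularity.Theorems.FiniteDissipationLiouville.LocalBalance

end
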